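import Summits.ResolutionOfSingularities.KangarooAtlas.MizutaniExtremalType
import Summits.ResolutionOfSingularities.KangarooAtlas.MizutaniLemma29Equality
import HarnessLib

/-!
# Mizutani's Thm. 2.8, second part, for odd `p`: «the same type as Example 2.1» — UNCONDITIONAL

Cell `pub-rosobs`, Mizutani enclosure (seat mizutani-encloser-1, gen 7, composing encloser-2 g7's
`span_coords_eq_of_extremal_of_lemma29` with encloser-1 g7's Lemma 2.9 (2) «⇒» `IsRootTower.exists_normalForm_of_finrank_ker_eq`).
AI-written; AI review is weaker than expert review; NOT a resolution-of-singularities theorem (summit relevance C).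

Mizutani (Nagoya Math. J. 52 (1973), Thm. 2.8, p. 90): «Moreover if `dim H = 2p − 1` and `H` is not a vector group with
`V ∩ W = {0}`, then `H` is of the same type as Example 2.1.»  Encloser-2 g7 proved this for odd `p` MODULO the «only if» half of
Lemma 2.9 (2) in tower form (hypothesis `hL29` of `span_coords_eq_of_extremal_of_lemma29`); that half is now the theorem
`IsRootTower.exists_normalForm_of_finrank_ker_eq` (`MizutaniLemma29Equality.lean`), applied to the tower `k^p(y₁, y₂)`
(`isRootTower_adjoin`).  Hence:

* **`span_coords_eq_of_extremal`** — `p` odd, extremal point: `n + 1 = 2p`, `𝔭 = [c^{1/p}]` with `c₀ = 1`, and for a `p`-basis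
  `(c₀', c₁')` of `k^p(y₁, y₂) ⊇ {c_i}`: `span_{k^p}{c_i} = k^p(c₀') ⊕ k^p(c₀')·c₁'` — no displayed hypothesis.

References: [Mizutani1973HironakaGroupSchemes] Thm. 2.8 (second part), Lemma 2.9 (2).
-/

noncomputable section

open MvPolynomial TensorProduct Literature.AlgebraicGeometry.Resolution
  Literature.AlgebraicGeometry.Resolution.HironakaScheme

namespace Summit.ResolutionOfSingularities.KangarooAtlas.Mizutani

universe u

section TypeHolds

variable (k : Type u) [Field k] (p : ℕ) [hp : Fact p.Prime] [CharP k p] {n : ℕ}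
  (𝔭 : Ideal (MvPolynomial (Fin (n + 1)) k))

/-- **THM. 2.8, SECOND PART, ODD `p`, «SAME TYPE AS EXAMPLE 2.1» — unconditional.**  For an extremal point (`p ≠ 2`, no linear
form, `(L_B)_1 ≠ 0`, `n + 2 = 2p + dim (L_B)_1`): `n + 1 = 2p`, `𝔭 = [c^{1/p}]` (`c_0 = 1`, `c` `k^p`-independent),
`{c_i} ⊆ k^p(y_1, y_2)` for a `p`-independent pair `y ⊆ {c_i}`, and for some `p`-basis `(c₀', c₁')` of `k^p(y_1,y_2)/k^p` the
`k^p`-span of the coordinates is `⊕_{m<p, j≤1} k^p·c₀'^m c₁'^j = k^p(c₀') ⊕ k^p(c₀')·c₁'` (Lemma 2.9 (2) «⇒» supplied by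
`IsRootTower.exists_normalForm_of_finrank_ker_eq`).
[cite: Mizutani1973HironakaGroupSchemes, Thm. 2.8 (second part) and its proof, Step (I); Lemma 2.9 (2)] -/
theorem span_coords_eq_of_extremal (hp2 : p ≠ 2) (hP : IsPoint k 𝔭) (h0 : invForms k p 𝔭 0 = ⊥)
    (hV : invForms k p 𝔭 1 ≠ ⊥) (hdim : n + 2 = 2 * p + Module.finrank k (invForms k p 𝔭 1)) :
    n + 1 = 2 * p ∧ ∃ (c : Fin (n + 1) → k) (y : Fin 2 → k) (_ : PIndep p 1 y) (hc : ∀ i, c i ∈ towerField 1 y)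
      (x' : Fin 2 → frobPow k p 1) (c' : Fin 2 → towerField 1 y)
      (_ : IsRootTower (frobPow k p 1) (towerField 1 y) (p ^ 1) x' c'),
      c 0 = 1 ∧ LinearIndependent (frobPow k p 1) c ∧ 𝔭 = ratPoint k p 1 c ∧ Set.range y ⊆ Set.range c ∧
      Submodule.span (frobPow k p 1) (Set.range fun i => (⟨c i, hc i⟩ : towerField 1 y)) =
        Submodule.span (frobPow k p 1) (Set.range fun mj : Fin p × Fin 2 => c' 0 ^ (mj.1 : ℕ) * c' 1 ^ (mj.2 : ℕ)) :=
  span_coords_eq_of_extremal_of_lemma29 k p 𝔭 hp2 hP h0 hV hdim fun _ hy _ hD _ h1 ha hker =>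
    (isRootTower_adjoin hy).exists_normalForm_of_finrank_ker_eq hp2 hD h1 ha hker

end TypeHolds

end Summit.ResolutionOfSingularities.KangarooAtlas.Mizutani

end
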